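import Summits.BirchSwinnertonDyer.BirchSwinnertonDyer.Theses.GoldfeldAllTwistsTwoConverse
import Summits.BirchSwinnertonDyer.BirchSwinnertonDyer.Theorems.GoldfeldGoodTwistsAllTwistsCells
import Summits.BirchSwinnertonDyer.Rank1Residual.P2.CellsAtTwo
import Summits.BirchSwinnertonDyer.BirchSwinnertonDyer.Theorems.GoldfeldAllTwistsTwoConverseTwinSplitCells
import Literature.NumberTheory.EllipticCurves.Wuthrich2014.ShaBoundProofs
import Literature.NumberTheory.EllipticCurves.ComplexMultiplicationShaKnappProofs
import HarnessLib

set_option linter.dupNamespace false -- namespace `…BirchSwinnertonDyer.BirchSwinnertonDyer…` is the cell's (D-0017 nested layout)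
set_option autoImplicit false

/-!
# Route `GoldfeldAllTwistsTwoConverse`, crux twin″ `BSDTwoCMSevenAdditiveRankOne` (item 19140):
# reductions — the CM corner ⟹ the item; isogeny reduction to `j = −3375`; twist currency

Cell `bsd-goldfeld`, seat `bsd-goldfeld-s1p-c301` (prover), file 1 of 2 on item `stmt-BirchSwinnertonDyer-19140`
(route decl `Summit.BirchSwinnertonDyer.BirchSwinnertonDyer.Theses.GoldfeldAllTwistsTwoConverse.BSDTwoCMSevenAdditiveRankOne`,
verbatim the cell `GoldfeldGoodTwists.BSDTwoCMSevenAdditiveRankOne` of file 13): Miller's `BSD(W,2)` for every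
globally minimal CM `W/ℚ` with `2` SPLIT in the CM field (`K = ℚ(√−7)`, `j ∈ {−3375, 16581375}`), NOT good
(hence additive, potentially good ordinary) at `2`, of analytic rank `1` — the quadratic twists `49a1^{(d)}`,
`d ≢ 1 (mod 4)`, and their `ℚ`-isogenous curves. NOT in print (Li–Tian–Yan–Zhu 2025 §1.3 (II) excludes
`2 ∣ N`; Miller 2011 covers `N < 5000` only). HONEST FRAMING: the item carries NO fact binder, so it is not
closed here; this file lands sorry-free REDUCTIONS of it (`--supports`); theorems only, no definition, no
axiom, no `sorry`, no instance, no notation; every published input is an explicit named-fact binder.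

What is proved:
* §1 `bsdTwoCMSevenAdditiveRankOne_of_bsdTwoOn_cm_rankOne`: the item is the literal restriction of
  `BSDTwoOn (CM ∧ r_an = 1)` (the 16-cell CM corner at `2` of `P2/CMRankOneAtTwoHeegnerIndex`; it is likewise
  the restriction of its parent `BSDTwoCMSplitRankOne` ≡ `P2.LTYZPotentiallyGoodOrdinaryAtTwo` — file 13's
  `ltyzPotentiallyGoodOrdinaryAtTwo_iff_additiveCell`, forward direction, not restated here);
  `bsdTwoCMSevenAdditiveRankOne_iff_cell`: route decl = file 13's cell, definitionally.
* §2 ISOGENY REDUCTION TO ONE `j`-INVARIANT (Cassels): granted Cassels' isogeny invariance of the BSD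
  quotient (`hCassels`), Gross–Zagier–Kolyvagin (`hGZK`) and analytic continuation (`hmod`), the item is
  EQUIVALENT to its restriction to `j(W) = −3375` (`bsdTwoCMSevenAdditiveRankOne_iff_j_neg3375`): a
  `ℚ(√−7)`-CM curve (`CMSplit W 2 ⟹ j ∈ {−3375, 16581375}`, seat s1p-c3's `j_eq_of_cmSplit_two`) is
  `ℚ`-isogenous to a globally minimal one with `j = −3375` (file 13), good reduction at
  `2` and the analytic rank are isogeny invariants, and so is `BSD(·,2)` in analytic rank `≤ 1`
  (`Wuthrich2014.bsdp_of_isIsogenous`). On `j = −3375` the hypotheses `HasCM`, `CMSplit W 2` are automatic.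
* §3 TWIST CURRENCY: a globally minimal `W` with `j = −3375` and bad reduction at `2` is a minimal model of
  `49a1^{(d)}` with `d` squarefree, `d ≢ 1 (mod 4)` (twists by `d ≡ 1 (mod 4)` stay good at `2`, file 1); hence
  `bsdTwoCMSevenAdditiveRankOne_of_twists`: `BSD(·,2)` for the minimal models of the analytic-rank-one twists
  `49a1^{(d)}`, `d ≢ 1 (mod 4)` — the currency of Coates–Li–Tian–Zhai / Li–Liu–Tian-type theorems — implies the
  item (granted Cassels/GZK/modularity), and conversely the item gives every additive-at-`2` twist instance.

File 2 (`GoldfeldAllTwistsTwoConverseTwinAdditiveHeegnerIndex`) types the CONTENT of the item: the `L`-free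
`2`-adic Heegner-index identity on the cell, with consumer and honesty clause.

References: Y.-X. Li, Y. Tian, X. Yan, X. Zhu, PAMQ 21 (2025), Thm. 1.1 (ii), §1.3 [LiTianYanZhu2025];
R. L. Miller, LMS J. Comput. Math. 14 (2011) Def. 1.1, Thm. 1.2 [Miller2011LMS]; J. S. Milne, *ADT* Thm. I.7.3
[MilneADT2006]; J. H. Silverman, *Advanced Topics* App. A §3 [SilvermanATAEC1994]; J. H. Silverman, *AEC* (2009)
X.5 Prop. 5.4, Cor. 5.4.1, VII.1.3 [SilvermanAEC2009]; A. Burungale, F. Castella, C. Skinner, Y. Tian,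
Ann. Math. Qué. 46 (2022) Rem. D [BurungaleCastellaSkinnerTian2022]; D. Burungale, M. Flach, 2024, p. 6
[BurungaleFlach2024].
-/

noncomputable section

open scoped Classical

open WeierstrassCurve NumberField Literature.NumberTheory.EllipticCurves
  Literature.NumberTheory.EllipticCurves.ModularForms
  Literature.NumberTheory.EllipticCurves.Rank1Residual
  Literature.NumberTheory.EllipticCurves.Rank1Residual.Typed

namespace Summit.BirchSwinnertonDyer.BirchSwinnertonDyer.Theorems.GoldfeldGoodTwists

open Summit.BirchSwinnertonDyer.Rank1Residual Summit.BirchSwinnertonDyer.Rank1Residual.P2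

/-! ## §1 The item is the literal restriction of the CM corner at `2` -/

/-- **The CM corner at `2` ⟹ the item (unconditional):** `BSD(·,2)` on {CM, `r_an = 1`} (the 16-cell
corner of `P2/CMRankOneAtTwoHeegnerIndex`) gives twin″ by restriction. [cite: BurungaleFlach2024, p. 6] -/
theorem bsdTwoCMSevenAdditiveRankOne_of_bsdTwoOn_cm_rankOne
    (h : BSDTwoOn fun W _ _ => W.HasCM ∧ W.analyticRank = 1) :
    Summit.BirchSwinnertonDyer.BirchSwinnertonDyer.Theses.GoldfeldAllTwistsTwoConverse.BSDTwoCMSevenAdditiveRankOne :=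
  fun W _ _ hCM _ _ har => h W (le_of_eq har) ⟨hCM, har⟩

/-- The route decl and file 13's cell `BSDTwoCMSevenAdditiveRankOne` are the same proposition (verbatim
bodies), so every theorem of file 13 about the cell is a theorem about the item. [cite: Miller2011LMS, Def. 1.1] -/
theorem bsdTwoCMSevenAdditiveRankOne_iff_cell :
    Summit.BirchSwinnertonDyer.BirchSwinnertonDyer.Theses.GoldfeldAllTwistsTwoConverse.BSDTwoCMSevenAdditiveRankOne ↔
      BSDTwoCMSevenAdditiveRankOne :=
  Iff.rfl

/-! ## §2 Isogeny reduction to the one `j`-invariant `−3375` (Cassels) -/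

/-- **The `j = −3375` form of the item (forward, unconditional):** on globally minimal curves with
`j = −3375` the hypotheses `HasCM` and `CMSplit W 2` hold automatically (`hasCM_of_j_eq_neg3375`,
`cmSplit_two_of_j_eq_neg3375`), so the item gives `BSD(W,2)` for every such `W`, NOT good at `2`, with
`r_an = 1` — the twists `49a1^{(d)}`, `d ≢ 1 (mod 4)`, on their minimal models.
[cite: SilvermanATAEC1994, App. A §3] [cite: Miller2011LMS, Def. 1.1] -/
theorem bsdTwo_j_neg3375_additive_of_bsdTwoCMSevenAdditiveRankOne
    (h : Summit.BirchSwinnertonDyer.BirchSwinnertonDyer.Theses.GoldfeldAllTwistsTwoConverse.BSDTwoCMSevenAdditiveRankOne) :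
    ∀ (W : WeierstrassCurve ℚ) [W.IsElliptic] [W.IsGloballyMinimal],
      W.j = -3375 → ¬ W.HasGoodReductionAtPrime 2 → W.analyticRank = 1 → BSDp W 2 :=
  fun W _ _ hj hg har => h W (hasCM_of_j_eq_neg3375 W hj) (cmSplit_two_of_j_eq_neg3375 W hj) hg har

/-- **Isogeny reduction (Cassels): the item from its `j = −3375` form.** Granted Cassels' invariance of
the BSD quotient under `ℚ`-isogeny (`hCassels`), Gross–Zagier–Kolyvagin (`hGZK`, finiteness of `Ш` in
analytic rank `≤ 1`) and analytic continuation (`hmod`, `L′(E,1) ≠ 0`): if `BSD(W′,2)` holds for every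
globally minimal `W′` with `j = −3375`, NOT good at `2`, `r_an = 1`, then the item holds. Proof: a curve with
`CMSplit W 2` has `j ∈ {−3375, 16581375}` and is `ℚ`-isogenous to a globally minimal `W′` with `j = −3375`
(file 13, `exists_isGloballyMinimal_isIsogenous_j_eq_neg3375`); good reduction at `2`
(`IsIsogenous.hasGoodReductionAtPrime_iff`, Serre–Tate) and `r_an` (Faltings) are isogeny invariants;
`BSD(·,2)` transports back along the isogeny (`Wuthrich2014.bsdp_of_isIsogenous`).
[cite: MilneADT2006, Thm. I.7.3 and Remark I.7.4] [cite: Miller2011LMS, §1 (isogeny invariance of BSD(E,p))]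
[cite: SilvermanATAEC1994, App. A §3] -/
theorem bsdTwoCMSevenAdditiveRankOne_of_j_neg3375 (hCassels : bsdRHS_eq_of_isIsogenous)
    (hGZK : rank_eq_analyticRank_of_analyticRank_le_one) (hmod : hasEntireLFunction_rat)
    (h : ∀ (W : WeierstrassCurve ℚ) [W.IsElliptic] [W.IsGloballyMinimal],
      W.j = -3375 → ¬ W.HasGoodReductionAtPrime 2 → W.analyticRank = 1 → BSDp W 2) :
    Summit.BirchSwinnertonDyer.BirchSwinnertonDyer.Theses.GoldfeldAllTwistsTwoConverse.BSDTwoCMSevenAdditiveRankOne := by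
  intro W _ _ _ hsplit hg har
  obtain ⟨W', hE', hmin', hiso, hj'⟩ :=
    exists_isGloballyMinimal_isIsogenous_j_eq_neg3375 W (j_eq_of_cmSplit_two W hsplit)
  haveI : Fact (Nat.Prime 2) := ⟨Nat.prime_two⟩
  have hg' : ¬ W'.HasGoodReductionAtPrime 2 := fun h' => hg ((hiso.hasGoodReductionAtPrime_iff 2).mpr h')
  have har' : W'.analyticRank = 1 := by rw [← analyticRank_eq_of_isIsogenous' hiso]; exact har
  obtain ⟨-, hfin'⟩ := hGZK W' (by rw [har'])
  exact Wuthrich2014.bsdp_of_isIsogenous hCassels hiso hfin'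
    (WeierstrassCurve.leadingLCoeff_ne_zero_holds (hmod W')) (h W' hj' hg' har')

/-- **The item ⟺ its `j = −3375` form**, granted Cassels, GZK and analytic continuation: the twin″ cell
is, up to `ℚ`-isogeny transport of `BSD(·,2)`, the statement for the additive-at-`2` quadratic twists of
`X₀(49) = 49a1` on their minimal models and nothing more. [cite: MilneADT2006, Thm. I.7.3]
[cite: Miller2011LMS, §1 and Def. 1.1] -/
theorem bsdTwoCMSevenAdditiveRankOne_iff_j_neg3375 (hCassels : bsdRHS_eq_of_isIsogenous)
    (hGZK : rank_eq_analyticRank_of_analyticRank_le_one) (hmod : hasEntireLFunction_rat) :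
    Summit.BirchSwinnertonDyer.BirchSwinnertonDyer.Theses.GoldfeldAllTwistsTwoConverse.BSDTwoCMSevenAdditiveRankOne ↔
      ∀ (W : WeierstrassCurve ℚ) [W.IsElliptic] [W.IsGloballyMinimal],
        W.j = -3375 → ¬ W.HasGoodReductionAtPrime 2 → W.analyticRank = 1 → BSDp W 2 :=
  ⟨bsdTwo_j_neg3375_additive_of_bsdTwoCMSevenAdditiveRankOne,
    bsdTwoCMSevenAdditiveRankOne_of_j_neg3375 hCassels hGZK hmod⟩

/-! ## §3 Twist currency: the item from a statement about the twists `49a1^{(d)}`, `d ≢ 1 (mod 4)` -/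

/-- **A globally minimal curve with `j = −3375` and bad reduction at `2` is a minimal model of a twist
`49a1^{(d)}` with `d` squarefree and `d ≢ 1 (mod 4)`.** Every curve with `j = −3375 = j(49a1)` is
`ℚ`-isomorphic to `cm7^{(d)}` for a squarefree `d ≠ 0` (Silverman X.5.4); if `d ≡ 1 (mod 4)` the minimal
model has GOOD reduction at `2` (file 1, `hasGoodReductionAtPrime_and_frobeniusTrace_of_smul_eq_quadraticTwist_two`,
since `49a1` is good at `2`), so bad reduction at `2` forces `d ≢ 1 (mod 4)`.
[cite: SilvermanAEC2009, X.5 Prop. 5.4 and Cor. 5.4.1] [cite: SilvermanAEC2009, VII.1 Prop. 1.3(b)] -/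
theorem exists_squarefree_twist_of_j_neg3375_of_not_good_two (W : WeierstrassCurve ℚ) [W.IsElliptic]
    [W.IsGloballyMinimal] (hj : W.j = -3375) (hg : ¬ W.HasGoodReductionAtPrime 2) :
    ∃ d : ℤ, d ≠ 0 ∧ Squarefree d ∧ d % 4 ≠ 1 ∧
      ∃ C : VariableChange ℚ, C • W = cm7.quadraticTwist (d : ℚ) := by
  obtain ⟨d, hd0, hsq, C, hC⟩ := exists_variableChange_eq_quadraticTwist_intCast_of_j_eq
    (W := W) (E := cm7) (by rw [hj, j_cm7]) (by rw [j_cm7]; norm_num) (by rw [j_cm7]; norm_num)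
  refine ⟨d, hd0, hsq, fun hd4 => hg ?_, C, hC⟩
  haveI : Fact (Nat.Prime 2) := ⟨Nat.prime_two⟩
  exact (hasGoodReductionAtPrime_and_frobeniusTrace_of_smul_eq_quadraticTwist_two cm7 W hd4 hC 2 rfl
    hasGoodReductionAtPrime_cm7_two).1

/-- **The `j = −3375` form of the item from the TWIST form (unconditional):** if `BSD(W′,2)` holds for
every globally minimal model `W′` of every twist `49a1^{(d)}`, `d` squarefree, `d ≢ 1 (mod 4)`, of
analytic rank `1` — the currency in which Coates–Li–Tian–Zhai / Li–Liu–Tian-type theorems are printed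
(`∃ C, C • W′ = cm7.quadraticTwist d`) — then `BSD(W,2)` holds for every globally minimal `W` with
`j = −3375`, NOT good at `2`, `r_an = 1`. [cite: SilvermanAEC2009, X.5 Cor. 5.4.1] [cite: Miller2011LMS, Def. 1.1] -/
theorem bsdTwo_j_neg3375_additive_of_twists
    (h : ∀ (d : ℤ), d ≠ 0 → Squarefree d → d % 4 ≠ 1 →
      ∀ (W' : WeierstrassCurve ℚ) [W'.IsElliptic] [W'.IsGloballyMinimal] (C : VariableChange ℚ),
        C • W' = cm7.quadraticTwist (d : ℚ) → W'.analyticRank = 1 → BSDp W' 2) :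
    ∀ (W : WeierstrassCurve ℚ) [W.IsElliptic] [W.IsGloballyMinimal],
      W.j = -3375 → ¬ W.HasGoodReductionAtPrime 2 → W.analyticRank = 1 → BSDp W 2 := by
  intro W _ _ hj hg har
  obtain ⟨d, hd0, hsq, hd4, C, hC⟩ := exists_squarefree_twist_of_j_neg3375_of_not_good_two W hj hg
  exact h d hd0 hsq hd4 W C hC har

/-- **The item from the TWIST form**, granted Cassels (`hCassels`), GZK (`hGZK`) and analytic
continuation (`hmod`) for the isogeny reduction of §2: `BSD(·,2)` for the minimal models of the
analytic-rank-one twists `49a1^{(d)}`, `d` squarefree, `d ≢ 1 (mod 4)`, implies twin″. So a printed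
theorem in twist currency on a sub-family discharges the corresponding instances of the item, and one
on all `d ≢ 1 (mod 4)` discharges it. [cite: MilneADT2006, Thm. I.7.3] [cite: SilvermanAEC2009, X.5 Cor. 5.4.1]
[cite: Miller2011LMS, §1 and Def. 1.1] -/
theorem bsdTwoCMSevenAdditiveRankOne_of_twists (hCassels : bsdRHS_eq_of_isIsogenous)
    (hGZK : rank_eq_analyticRank_of_analyticRank_le_one) (hmod : hasEntireLFunction_rat)
    (h : ∀ (d : ℤ), d ≠ 0 → Squarefree d → d % 4 ≠ 1 →
      ∀ (W' : WeierstrassCurve ℚ) [W'.IsElliptic] [W'.IsGloballyMinimal] (C : VariableChange ℚ),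
        C • W' = cm7.quadraticTwist (d : ℚ) → W'.analyticRank = 1 → BSDp W' 2) :
    Summit.BirchSwinnertonDyer.BirchSwinnertonDyer.Theses.GoldfeldAllTwistsTwoConverse.BSDTwoCMSevenAdditiveRankOne :=
  bsdTwoCMSevenAdditiveRankOne_of_j_neg3375 hCassels hGZK hmod (bsdTwo_j_neg3375_additive_of_twists h)

/-- **Conversely (unconditional), the item gives `BSD(W′,2)` for every globally minimal model `W′` of
every twist `49a1^{(d)}` (`d ≠ 0`) that is NOT good at `2`, in analytic rank one** (such a `W′` has
`j = −3375`, CM and `2` split: file 12, `minimalModel_quadraticTwist_cm7`).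
[cite: SilvermanAEC2009, X.§5 Cor. 5.4.1] [cite: Miller2011LMS, Def. 1.1] -/
theorem bsdTwo_twists_additive_of_bsdTwoCMSevenAdditiveRankOne
    (h : Summit.BirchSwinnertonDyer.BirchSwinnertonDyer.Theses.GoldfeldAllTwistsTwoConverse.BSDTwoCMSevenAdditiveRankOne)
    {d : ℤ} (hd0 : d ≠ 0) (W' : WeierstrassCurve ℚ) [W'.IsElliptic] [W'.IsGloballyMinimal]
    (C : VariableChange ℚ) (hC : C • W' = cm7.quadraticTwist (d : ℚ))
    (hg : ¬ W'.HasGoodReductionAtPrime 2) (har : W'.analyticRank = 1) : BSDp W' 2 := by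
  obtain ⟨-, hCM, hsplit⟩ := minimalModel_quadraticTwist_cm7 hd0 W' C hC
  exact h W' hCM hsplit hg har

end Summit.BirchSwinnertonDyer.BirchSwinnertonDyer.Theorems.GoldfeldGoodTwists

end
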